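import Mathlib
import Literature.NumberTheory.Sieve.GeometricGridDecomposition
import Literature.NumberTheory.Sieve.LinearPairConfigurationCounting

/-!
# Crux `PolyMobiusTail` (stmt-Parity-0870), line `eta-free-multilinear-window`, stub `stub_pair_middle`
# (middle / dispersion range of the linear pair window) — helper 1: shell cards over the fine grid

Over the fine `(d₀, m)`-grid of the one-sided middle triple sum, the per-box shell configurations of
`stub_pair_middle_box_reduction2` add up to at most the three UNIFORM shell counts (two thin hyperbolic
shells `X < d₀d₁ ≤ X(1+2κ)` in `(n,d₀,d₁)` form, counted by `LinearPairShells.card_shell_le`, and a short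
`n`-interval counted by `τ·τ`). Head: the registered auxiliary stub `stub_pair_middle_shellcards`.
-/

open scoped BigOperators
open Finset Real Filter Polynomial Asymptotics

namespace Summit.Parity.BatemanHorn.Theorems.PolyMobiusTail.EtaFreeWindow

namespace MiddleAssembly

open Literature.NumberTheory.Sieve Literature.NumberTheory.Sieve.GeometricGrid Literature.NumberTheory.Sieve.LinearPairConfig

/-- **Cards of filters as indicator sums** over a product finset. -/
theorem card_filter_eq_sum_ite {α : Type*} (s : Finset α) (p : α → Prop) [DecidablePred p] :
    ((s.filter p).card : ℝ) = ∑ a ∈ s, if p a then (1 : ℝ) else 0 := by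
  rw [Finset.card_filter]; push_cast
  rfl

/-- **Sum of the per-box shell counts.**  With `P'/P ≤ 1+2κ` on the `d₀`-grid and
`Mb' ≤ (1+2κ)(Mb+1)` on the `m`-grid, the per-box shell configurations (as in
`stub_pair_middle_box_reduction2`) add up to at most the three UNIFORM shell counts:
`d₀d₁ ∈ (x^{1-η}, x^{1-η}(1+2κ)]`, `d₀d₁ ∈ (x^{1+θ}/(1+2κ), x^{1+θ}]` (counted over `(n,d₀,d₁)`), and
`n > x − ⌈2κ(x+|a₁|)⌉₊` (counted by `τ·τ`). -/
theorem shell_cards_sum_le {q₀ a₀ q₁ a₁ : ℤ} (hq₁ : 0 < q₁) {x Xb BP TP M₀ TM SP SM : ℕ}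
    (bP bM : ℕ → ℕ) (hbP : Monotone bP) (hbM : Monotone bM) (hP0 : bP 0 = BP) (hPS : bP SP = TP)
    (hM0 : bM 0 = M₀) (hMS : bM SM = TM) (hTP : TP ≤ Xb) (hM₀ : M₀ ≤ TM) (hTMX : TM ≤ Xb)
    (hBP : 1 ≤ BP) {κ θ η : ℝ} (hκ : 0 < κ) (hax : (a₁.natAbs : ℕ) ≤ x)
    (hratP : ∀ s, ((bP (s + 1) : ℕ) : ℝ) ≤ (1 + 2 * κ) * bP s)
    (hratM : ∀ j, ((bM (j + 1) : ℕ) : ℝ) ≤ (1 + 2 * κ) * ((bM j : ℝ) + 1)) :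
    (∑ s ∈ range SP, ∑ j ∈ range SM,
      ((((Finset.Ioc (bP s) (bP (s + 1)) ×ˢ Finset.Icc 1 Xb) ×ˢ Finset.Ioc (bM j) (bM (j + 1))).filter
        (fun c : (ℕ × ℕ) × ℕ =>
          (((c.1.2 : ℤ) * c.2 - a₁) % q₁ = 0 ∧
            (1 ≤ ((c.1.2 : ℤ) * c.2 - a₁) / q₁ ∧ ((c.1.2 : ℤ) * c.2 - a₁) / q₁ ≤ x) ∧
            (1 ≤ q₀ * (((c.1.2 : ℤ) * c.2 - a₁) / q₁) + a₀ ∧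
              (c.1.1 : ℤ) ∣ q₀ * (((c.1.2 : ℤ) * c.2 - a₁) / q₁) + a₀)) ∧
          (((x : ℝ) ^ (1 - η) < (c.1.1 : ℝ) * c.1.2 ∧
              (c.1.1 : ℝ) * c.1.2 ≤ (x : ℝ) ^ (1 - η) * (bP (s + 1) : ℕ) / (bP s : ℕ)) ∨
           ((x : ℝ) ^ (1 + θ) * (bP s : ℕ) / (bP (s + 1) : ℕ) < (c.1.1 : ℝ) * c.1.2 ∧
              (c.1.1 : ℝ) * c.1.2 ≤ (x : ℝ) ^ (1 + θ)) ∨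
           (((q₁ : ℝ) * x + a₁) * ((bM j : ℕ) + 1) / (bM (j + 1) : ℕ) < (c.1.2 : ℝ) * c.2)))).card : ℝ)) ≤
    ((((Icc 1 x) ×ˢ ((Icc 1 Xb) ×ˢ (Icc 1 Xb))).filter fun e : ℕ × ℕ × ℕ =>
        ((1 ≤ q₀ * e.1 + a₀ ∧ (e.2.1 : ℤ) ∣ q₀ * e.1 + a₀) ∧
          (1 ≤ q₁ * e.1 + a₁ ∧ (e.2.2 : ℤ) ∣ q₁ * e.1 + a₁)) ∧
        ((x : ℝ) ^ (1 - η) < (e.2.1 : ℝ) * e.2.2 ∧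
          (e.2.1 : ℝ) * e.2.2 ≤ (x : ℝ) ^ (1 - η) + (2 * κ) * (x : ℝ) ^ (1 - η))).card : ℝ) +
    ((((Icc 1 x) ×ˢ ((Icc 1 Xb) ×ˢ (Icc 1 Xb))).filter fun e : ℕ × ℕ × ℕ =>
        ((1 ≤ q₀ * e.1 + a₀ ∧ (e.2.1 : ℤ) ∣ q₀ * e.1 + a₀) ∧
          (1 ≤ q₁ * e.1 + a₁ ∧ (e.2.2 : ℤ) ∣ q₁ * e.1 + a₁)) ∧
        ((x : ℝ) ^ (1 + θ) / (1 + 2 * κ) < (e.2.1 : ℝ) * e.2.2 ∧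
          (e.2.1 : ℝ) * e.2.2 ≤ (x : ℝ) ^ (1 + θ) / (1 + 2 * κ) + (2 * κ) * ((x : ℝ) ^ (1 + θ) / (1 + 2 * κ)))).card : ℝ) +
    ∑ n ∈ Ioc (x - ⌈2 * κ * ((x : ℝ) + a₁.natAbs)⌉₊) x,
      ((((q₀ * n + a₀).toNat).divisors.card : ℕ) : ℝ) * ((((q₁ * n + a₁).toNat).divisors.card : ℕ) : ℝ) := by
  classical
  -- notation for the three uniform shells (predicates on `(d₀,d₁,m)`)
  set y : ℕ := ⌈2 * κ * ((x : ℝ) + a₁.natAbs)⌉₊ with hy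
  -- Core predicate
  let Core : (ℕ × ℕ) × ℕ → Prop := fun c =>
    ((c.1.2 : ℤ) * c.2 - a₁) % q₁ = 0 ∧
      (1 ≤ ((c.1.2 : ℤ) * c.2 - a₁) / q₁ ∧ ((c.1.2 : ℤ) * c.2 - a₁) / q₁ ≤ x) ∧
      (1 ≤ q₀ * (((c.1.2 : ℤ) * c.2 - a₁) / q₁) + a₀ ∧
        (c.1.1 : ℤ) ∣ q₀ * (((c.1.2 : ℤ) * c.2 - a₁) / q₁) + a₀)
  let U₁ : (ℕ × ℕ) × ℕ → Prop := fun c =>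
    (x : ℝ) ^ (1 - η) < (c.1.1 : ℝ) * c.1.2 ∧ (c.1.1 : ℝ) * c.1.2 ≤ (x : ℝ) ^ (1 - η) + (2 * κ) * (x : ℝ) ^ (1 - η)
  let U₂ : (ℕ × ℕ) × ℕ → Prop := fun c =>
    (x : ℝ) ^ (1 + θ) / (1 + 2 * κ) < (c.1.1 : ℝ) * c.1.2 ∧
      (c.1.1 : ℝ) * c.1.2 ≤ (x : ℝ) ^ (1 + θ) / (1 + 2 * κ) + (2 * κ) * ((x : ℝ) ^ (1 + θ) / (1 + 2 * κ))
  let U₃ : (ℕ × ℕ) × ℕ → Prop := fun c => ((x : ℝ) - y < (((c.1.2 : ℤ) * c.2 - a₁) / q₁ : ℤ))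
  let U : (ℕ × ℕ) × ℕ → Prop := fun c => U₁ c ∨ U₂ c ∨ U₃ c
  -- basic facts on the grids
  have hbP_pos : ∀ s, 0 < bP s := fun s => by
    have : bP 0 ≤ bP s := hbP (Nat.zero_le s)
    rw [hP0] at this; omega
  have hbP_le_TP : ∀ s, s < SP → bP (s + 1) ≤ TP := fun s hs => by
    rw [← hPS]; exact hbP (Nat.succ_le_of_lt hs)
  have hbP_ge_BP : ∀ s, BP ≤ bP s := fun s => by rw [← hP0]; exact hbP (Nat.zero_le s)
  have hbM_le_TM : ∀ j, j < SM → bM (j + 1) ≤ TM := fun j hj => by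
    rw [← hMS]; exact hbM (Nat.succ_le_of_lt hj)
  have hx1η : 0 ≤ (x : ℝ) ^ (1 - η) := by positivity
  have hx1θ : 0 ≤ (x : ℝ) ^ (1 + θ) := by positivity
  have h12κ : 0 < 1 + 2 * κ := by linarith
  have hqxa : 0 ≤ (q₁ : ℝ) * x + a₁ := by
    have h1 : (1 : ℝ) ≤ q₁ := by exact_mod_cast hq₁
    have h2 : ((a₁.natAbs : ℕ) : ℝ) ≤ x := by exact_mod_cast hax
    have h3 : -(a₁ : ℝ) ≤ ((a₁.natAbs : ℕ) : ℝ) := by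
      rw [Nat.cast_natAbs, Int.cast_abs]; exact neg_le_abs _
    have hx0 : (0 : ℝ) ≤ x := Nat.cast_nonneg x
    nlinarith
  -- Step 1: per box, the box shells imply the uniform shells
  have step1 : ∀ s ∈ range SP, ∀ j ∈ range SM,
      ((((Finset.Ioc (bP s) (bP (s + 1)) ×ˢ Finset.Icc 1 Xb) ×ˢ Finset.Ioc (bM j) (bM (j + 1))).filter
        (fun c : (ℕ × ℕ) × ℕ => Core c ∧
          (((x : ℝ) ^ (1 - η) < (c.1.1 : ℝ) * c.1.2 ∧
              (c.1.1 : ℝ) * c.1.2 ≤ (x : ℝ) ^ (1 - η) * (bP (s + 1) : ℕ) / (bP s : ℕ)) ∨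
           ((x : ℝ) ^ (1 + θ) * (bP s : ℕ) / (bP (s + 1) : ℕ) < (c.1.1 : ℝ) * c.1.2 ∧
              (c.1.1 : ℝ) * c.1.2 ≤ (x : ℝ) ^ (1 + θ)) ∨
           (((q₁ : ℝ) * x + a₁) * ((bM j : ℕ) + 1) / (bM (j + 1) : ℕ) < (c.1.2 : ℝ) * c.2)))).card : ℝ) ≤
      ∑ d₀ ∈ Finset.Ioc (bP s) (bP (s + 1)), ∑ d₁ ∈ Finset.Icc 1 Xb, ∑ m ∈ Finset.Ioc (bM j) (bM (j + 1)),
        (if (Core ((d₀, d₁), m) ∧ U ((d₀, d₁), m)) ∧ (BP < d₀ ∧ d₀ ≤ TP) ∧ m ≤ TM then (1 : ℝ) else 0) := by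
    intro s hs j hj
    rw [Finset.mem_range] at hs hj
    rw [card_filter_eq_sum_ite, sum_sum_sum_eq_sum_prod]
    refine Finset.sum_le_sum fun c hc => ?_
    rw [Finset.mem_product, Finset.mem_product, Finset.mem_Ioc, Finset.mem_Icc, Finset.mem_Ioc] at hc
    obtain ⟨⟨⟨hd₀l, hd₀u⟩, hd₁1, hd₁X⟩, hml, hmu⟩ := hc
    have hP0r : (0 : ℝ) < (bP s : ℕ) := by exact_mod_cast hbP_pos s
    have hP'0r : (0 : ℝ) < (bP (s + 1) : ℕ) := by exact_mod_cast hbP_pos (s + 1)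
    have hMb'0 : (0 : ℝ) < (bM (j + 1) : ℕ) := by exact_mod_cast (show 0 < bM (j + 1) by omega)
    split_ifs with h1 h2
    · exact le_rfl
    · exfalso
      refine h2 ⟨⟨h1.1, ?_⟩, ⟨lt_of_le_of_lt (hbP_ge_BP s) hd₀l, hd₀u.trans (hbP_le_TP s hs)⟩,
        hmu.trans (hbM_le_TM j hj)⟩
      obtain ⟨hcore, hsh⟩ := h1
      rcases hsh with ⟨hlo, hhi⟩ | ⟨hlo, hhi⟩ | h3
      · refine Or.inl ⟨hlo, hhi.trans ?_⟩
        rw [div_le_iff₀ hP0r]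
        have := hratP s
        nlinarith
      · refine Or.inr (Or.inl ⟨lt_of_le_of_lt ?_ hlo, ?_⟩)
        · rw [div_le_div_iff₀ h12κ hP'0r]
          have := hratP s
          nlinarith
        · have : (x : ℝ) ^ (1 + θ) / (1 + 2 * κ) + 2 * κ * ((x : ℝ) ^ (1 + θ) / (1 + 2 * κ)) =
              (x : ℝ) ^ (1 + θ) := by
            rw [show (x : ℝ) ^ (1 + θ) / (1 + 2 * κ) + 2 * κ * ((x : ℝ) ^ (1 + θ) / (1 + 2 * κ)) =
              (1 + 2 * κ) * ((x : ℝ) ^ (1 + θ) / (1 + 2 * κ)) by ring, mul_div_cancel₀ _ h12κ.ne']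
          rw [this]; exact hhi
      · -- shell₃ ⟹ `n > x - y`
        refine Or.inr (Or.inr ?_)
        obtain ⟨hC1, ⟨hn1, hnx⟩, -, -⟩ := hcore
        set nn : ℤ := ((c.1.2 : ℤ) * c.2 - a₁) / q₁ with hnn
        have hq : q₁ * nn = (c.1.2 : ℤ) * c.2 - a₁ := Int.mul_ediv_cancel' (Int.dvd_of_emod_eq_zero hC1)
        have hqR : (q₁ : ℝ) * nn = (c.1.2 : ℝ) * c.2 - a₁ := by exact_mod_cast hq
        show (x : ℝ) - y < (nn : ℝ)
        have hM := hratM j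
        -- `(q₁x+a₁)(Mb+1)/Mb' ≥ (q₁ x + a₁)/(1+2κ)`
        have hlow : ((q₁ : ℝ) * x + a₁) / (1 + 2 * κ) ≤
            ((q₁ : ℝ) * x + a₁) * ((bM j : ℕ) + 1) / (bM (j + 1) : ℕ) := by
          rw [div_le_div_iff₀ h12κ hMb'0]
          have h0 : 0 ≤ ((bM j : ℕ) : ℝ) + 1 := by positivity
          nlinarith [mul_nonneg hqxa h0]
        have hlt : ((q₁ : ℝ) * x + a₁) / (1 + 2 * κ) < (q₁ : ℝ) * nn + a₁ := by
          rw [hqR]; linarith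
        -- hence `q₁ nn > (q₁ x - 2κ a₁)/(1+2κ)` and `nn > x - 2κ(x+|a₁|)`
        have hq₁R : (0 : ℝ) < q₁ := by exact_mod_cast hq₁
        have hq₁1 : (1 : ℝ) ≤ q₁ := by exact_mod_cast hq₁
        have habs : |(a₁ : ℝ)| = ((a₁.natAbs : ℕ) : ℝ) := by
          rw [Nat.cast_natAbs, Int.cast_abs]
        have hy' : 2 * κ * ((x : ℝ) + a₁.natAbs) ≤ y := Nat.le_ceil _
        have hineq : (x : ℝ) - 2 * κ * ((x : ℝ) + a₁.natAbs) < nn := by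
          rw [div_lt_iff₀ h12κ] at hlt
          -- `q₁ x + a₁ < (q₁ nn + a₁)(1+2κ)` ⟹ `q₁ (x - nn - 2κ nn) < 2κ a₁ ≤ 2κ|a₁| q₁`
          have h5 : (q₁ : ℝ) * (x - nn - 2 * κ * nn) < 2 * κ * a₁ := by linarith
          have h6 : (a₁ : ℝ) ≤ a₁.natAbs := by rw [← habs]; exact le_abs_self _
          have hA0 : 0 ≤ 2 * κ * (a₁.natAbs : ℝ) := by positivity
          have h6' : 2 * κ * (a₁ : ℝ) ≤ 2 * κ * a₁.natAbs := by
            exact mul_le_mul_of_nonneg_left h6 (by positivity)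
          have h6'' : 2 * κ * (a₁.natAbs : ℝ) ≤ q₁ * (2 * κ * a₁.natAbs) := by
            have := mul_le_mul_of_nonneg_right hq₁1 hA0
            linarith
          have h7 : (q₁ : ℝ) * (x - nn - 2 * κ * nn) < q₁ * (2 * κ * a₁.natAbs) := by linarith
          have h8 : (x : ℝ) - nn - 2 * κ * nn < 2 * κ * a₁.natAbs := lt_of_mul_lt_mul_left h7 hq₁R.le
          have hnnx : (nn : ℝ) ≤ x := by exact_mod_cast hnx
          have h9 : 2 * κ * (nn : ℝ) ≤ 2 * κ * x := mul_le_mul_of_nonneg_left hnnx (by positivity)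
          linarith
        linarith
    · positivity
    · exact le_rfl
  -- Step 2: the indicator `g'` and its decomposition over the grid
  set g' : ℕ → ℕ → ℕ → ℝ := fun d₀ d₁ m =>
    if (Core ((d₀, d₁), m) ∧ U ((d₀, d₁), m)) ∧ (BP < d₀ ∧ d₀ ≤ TP) ∧ m ≤ TM then (1 : ℝ) else 0 with hg'
  have hg'0 : ∀ d₀ d₁ m, g' d₀ d₁ m ≠ 0 → BP < d₀ ∧ d₀ ≤ TP := by
    intro d₀ d₁ m h
    by_contra hc
    exact h (if_neg fun hh => hc hh.2.1)
  have hg'm : ∀ d₀ d₁ m, g' d₀ d₁ m ≠ 0 → m ≤ TM := by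
    intro d₀ d₁ m h
    by_contra hc
    exact h (if_neg fun hh => hc hh.2.2)
  have hg'nn : ∀ d₀ d₁ m, 0 ≤ g' d₀ d₁ m := by
    intro d₀ d₁ m; simp only [hg']; split_ifs <;> norm_num
  have hg'le : ∀ d₀ d₁ m, g' d₀ d₁ m ≤ (if Core ((d₀, d₁), m) ∧ U ((d₀, d₁), m) then (1 : ℝ) else 0) := by
    intro d₀ d₁ m; simp only [hg']
    split_ifs with h1 h2
    · exact le_rfl
    · exact absurd h1.1 h2
    · norm_num
    · exact le_rfl
  have hdec := tripleSum_decomp g' bP bM hbP hbM hP0 hPS hM0 hMS hTP hM₀ hTMX hg'0 hg'm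
  have hsmall0 : 0 ≤ ∑ d₀ ∈ Icc 1 Xb, ∑ d₁ ∈ Icc 1 Xb, ∑ m ∈ Icc 1 M₀, g' d₀ d₁ m :=
    Finset.sum_nonneg fun _ _ => Finset.sum_nonneg fun _ _ => Finset.sum_nonneg fun _ _ => hg'nn _ _ _
  -- Step 3: the full sum of `g'` is at most the card of `Core ∧ U` on the cube
  set cube : Finset ((ℕ × ℕ) × ℕ) := (Icc 1 Xb ×ˢ Icc 1 Xb) ×ˢ Icc 1 Xb with hcube
  have hfull : ∑ d₀ ∈ Icc 1 Xb, ∑ d₁ ∈ Icc 1 Xb, ∑ m ∈ Icc 1 Xb, g' d₀ d₁ m ≤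
      ((cube.filter (fun c => Core c ∧ U c)).card : ℝ) := by
    rw [card_filter_eq_sum_ite, hcube, sum_sum_sum_eq_sum_prod]
    exact Finset.sum_le_sum fun p _ => hg'le p.1.1 p.1.2 p.2
  -- Step 4: split `U` into the three shells
  have hsplit : ((cube.filter (fun c => Core c ∧ U c)).card : ℝ) ≤
      ((cube.filter (fun c => Core c ∧ U₁ c)).card : ℝ) + ((cube.filter (fun c => Core c ∧ U₂ c)).card : ℝ) +
        ((cube.filter (fun c => Core c ∧ U₃ c)).card : ℝ) := by
    have hsub : cube.filter (fun c => Core c ∧ U c) ⊆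
        cube.filter (fun c => Core c ∧ U₁ c) ∪ cube.filter (fun c => Core c ∧ U₂ c) ∪
          cube.filter (fun c => Core c ∧ U₃ c) := by
      intro c hc
      rw [Finset.mem_filter] at hc
      rw [Finset.mem_union, Finset.mem_union, Finset.mem_filter, Finset.mem_filter, Finset.mem_filter]
      rcases hc.2.2 with h | h | h
      · exact Or.inl (Or.inl ⟨hc.1, hc.2.1, h⟩)
      · exact Or.inl (Or.inr ⟨hc.1, hc.2.1, h⟩)
      · exact Or.inr ⟨hc.1, hc.2.1, h⟩
    have h1 := Finset.card_le_card hsub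
    have h2 := Finset.card_union_le (cube.filter (fun c => Core c ∧ U₁ c) ∪ cube.filter (fun c => Core c ∧ U₂ c))
      (cube.filter (fun c => Core c ∧ U₃ c))
    have h3 := Finset.card_union_le (cube.filter (fun c => Core c ∧ U₁ c)) (cube.filter (fun c => Core c ∧ U₂ c))
    have : (cube.filter (fun c => Core c ∧ U c)).card ≤
        (cube.filter (fun c => Core c ∧ U₁ c)).card + (cube.filter (fun c => Core c ∧ U₂ c)).card +
          (cube.filter (fun c => Core c ∧ U₃ c)).card := by omega
    exact_mod_cast this
  -- Step 5: the three injections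
  have hMset : ∀ m ∈ Icc 1 Xb, 1 ≤ m := fun m hm => (Finset.mem_Icc.mp hm).1
  have hI₁ : (cube.filter (fun c => Core c ∧ U₁ c)).card ≤
      (((Icc 1 x) ×ˢ ((Icc 1 Xb) ×ˢ (Icc 1 Xb))).filter fun e : ℕ × ℕ × ℕ =>
        ((1 ≤ q₀ * e.1 + a₀ ∧ (e.2.1 : ℤ) ∣ q₀ * e.1 + a₀) ∧
          (1 ≤ q₁ * e.1 + a₁ ∧ (e.2.2 : ℤ) ∣ q₁ * e.1 + a₁)) ∧
        ((x : ℝ) ^ (1 - η) < (e.2.1 : ℝ) * e.2.2 ∧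
          (e.2.1 : ℝ) * e.2.2 ≤ (x : ℝ) ^ (1 - η) + (2 * κ) * (x : ℝ) ^ (1 - η))).card :=
    card_core_filter_le (q₀ := q₀) (a₀ := a₀) (Finset.Subset.refl _) hMset
      (fun p _ => (x : ℝ) ^ (1 - η) < (p.1 : ℝ) * p.2 ∧ (p.1 : ℝ) * p.2 ≤ (x : ℝ) ^ (1 - η) + (2 * κ) * (x : ℝ) ^ (1 - η))
      (fun _ p => (x : ℝ) ^ (1 - η) < (p.1 : ℝ) * p.2 ∧ (p.1 : ℝ) * p.2 ≤ (x : ℝ) ^ (1 - η) + (2 * κ) * (x : ℝ) ^ (1 - η))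
      (fun _ _ _ _ _ _ _ h => h)
  have hI₂ : (cube.filter (fun c => Core c ∧ U₂ c)).card ≤
      (((Icc 1 x) ×ˢ ((Icc 1 Xb) ×ˢ (Icc 1 Xb))).filter fun e : ℕ × ℕ × ℕ =>
        ((1 ≤ q₀ * e.1 + a₀ ∧ (e.2.1 : ℤ) ∣ q₀ * e.1 + a₀) ∧
          (1 ≤ q₁ * e.1 + a₁ ∧ (e.2.2 : ℤ) ∣ q₁ * e.1 + a₁)) ∧
        ((x : ℝ) ^ (1 + θ) / (1 + 2 * κ) < (e.2.1 : ℝ) * e.2.2 ∧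
          (e.2.1 : ℝ) * e.2.2 ≤ (x : ℝ) ^ (1 + θ) / (1 + 2 * κ) + (2 * κ) * ((x : ℝ) ^ (1 + θ) / (1 + 2 * κ)))).card :=
    card_core_filter_le (q₀ := q₀) (a₀ := a₀) (Finset.Subset.refl _) hMset
      (fun p _ => (x : ℝ) ^ (1 + θ) / (1 + 2 * κ) < (p.1 : ℝ) * p.2 ∧
        (p.1 : ℝ) * p.2 ≤ (x : ℝ) ^ (1 + θ) / (1 + 2 * κ) + (2 * κ) * ((x : ℝ) ^ (1 + θ) / (1 + 2 * κ)))
      (fun _ p => (x : ℝ) ^ (1 + θ) / (1 + 2 * κ) < (p.1 : ℝ) * p.2 ∧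
        (p.1 : ℝ) * p.2 ≤ (x : ℝ) ^ (1 + θ) / (1 + 2 * κ) + (2 * κ) * ((x : ℝ) ^ (1 + θ) / (1 + 2 * κ)))
      (fun _ _ _ _ _ _ _ h => h)
  have hI₃ : (cube.filter (fun c => Core c ∧ U₃ c)).card ≤
      (((Icc 1 x) ×ˢ ((Icc 1 Xb) ×ˢ (Icc 1 Xb))).filter fun e : ℕ × ℕ × ℕ =>
        ((1 ≤ q₀ * e.1 + a₀ ∧ (e.2.1 : ℤ) ∣ q₀ * e.1 + a₀) ∧
          (1 ≤ q₁ * e.1 + a₁ ∧ (e.2.2 : ℤ) ∣ q₁ * e.1 + a₁)) ∧ ((x : ℝ) - y < e.1)).card := by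
    refine card_core_filter_le (q₀ := q₀) (a₀ := a₀) (Finset.Subset.refl _) hMset
      (fun p m => ((x : ℝ) - y < (((p.2 : ℤ) * m - a₁) / q₁ : ℤ))) (fun n _ => (x : ℝ) - y < n) ?_
    intro d₀ d₁ m _ _ _ hn h
    have h0 : (0 : ℤ) ≤ ((d₁ : ℤ) * m - a₁) / q₁ := by omega
    have : ((((((d₁ : ℤ) * m - a₁) / q₁).toNat : ℕ) : ℤ) : ℝ) = ((((d₁ : ℤ) * m - a₁) / q₁ : ℤ) : ℝ) := by
      rw [Int.toNat_of_nonneg h0]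
    rw [Int.cast_natCast] at this
    rw [this]; exact h
  -- Step 6: the third count is a `τ·τ` sum over `n ∈ (x - y, x]`
  have hI₃' : ((((Icc 1 x) ×ˢ ((Icc 1 Xb) ×ˢ (Icc 1 Xb))).filter fun e : ℕ × ℕ × ℕ =>
        ((1 ≤ q₀ * e.1 + a₀ ∧ (e.2.1 : ℤ) ∣ q₀ * e.1 + a₀) ∧
          (1 ≤ q₁ * e.1 + a₁ ∧ (e.2.2 : ℤ) ∣ q₁ * e.1 + a₁)) ∧ ((x : ℝ) - y < e.1)).card : ℝ) ≤
      ∑ n ∈ Ioc (x - y) x,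
        ((((q₀ * n + a₀).toNat).divisors.card : ℕ) : ℝ) * ((((q₁ * n + a₁).toNat).divisors.card : ℕ) : ℝ) := by
    have hsub : (((Icc 1 x) ×ˢ ((Icc 1 Xb) ×ˢ (Icc 1 Xb))).filter fun e : ℕ × ℕ × ℕ =>
        ((1 ≤ q₀ * e.1 + a₀ ∧ (e.2.1 : ℤ) ∣ q₀ * e.1 + a₀) ∧
          (1 ≤ q₁ * e.1 + a₁ ∧ (e.2.2 : ℤ) ∣ q₁ * e.1 + a₁)) ∧ ((x : ℝ) - y < e.1)) ⊆
        ((Ioc (x - y) x) ×ˢ ((Icc 1 Xb) ×ˢ (Icc 1 Xb))).filter (fun e : ℕ × (ℕ × ℕ) =>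
          ((1 ≤ q₀ * e.1 + a₀ ∧ (e.2.1 : ℤ) ∣ q₀ * e.1 + a₀) ∧
            (1 ≤ q₁ * e.1 + a₁ ∧ (e.2.2 : ℤ) ∣ q₁ * e.1 + a₁)) ∧ True) := by
      intro e he
      rw [Finset.mem_filter, Finset.mem_product] at he ⊢
      obtain ⟨⟨hn, hd⟩, hcore, hlt⟩ := he
      refine ⟨⟨?_, hd⟩, hcore, trivial⟩
      rw [Finset.mem_Icc] at hn
      rw [Finset.mem_Ioc]
      refine ⟨?_, hn.2⟩
      -- `x - y < e.1` in `ℕ` from the real inequality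
      by_contra hcon
      push Not at hcon
      rcases le_total y x with hyx | hyx
      · have h1 : ((x - y : ℕ) : ℝ) = (x : ℝ) - y := by rw [Nat.cast_sub hyx]
        have h2 : ((x - y : ℕ) : ℝ) ≥ e.1 := by exact_mod_cast hcon
        linarith
      · rw [Nat.sub_eq_zero_of_le hyx] at hcon
        omega
    calc ((((Icc 1 x) ×ˢ ((Icc 1 Xb) ×ˢ (Icc 1 Xb))).filter fun e : ℕ × ℕ × ℕ =>
        ((1 ≤ q₀ * e.1 + a₀ ∧ (e.2.1 : ℤ) ∣ q₀ * e.1 + a₀) ∧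
          (1 ≤ q₁ * e.1 + a₁ ∧ (e.2.2 : ℤ) ∣ q₁ * e.1 + a₁)) ∧ ((x : ℝ) - y < e.1)).card : ℝ)
        ≤ ((((Ioc (x - y) x) ×ˢ ((Icc 1 Xb) ×ˢ (Icc 1 Xb))).filter (fun e : ℕ × (ℕ × ℕ) =>
          ((1 ≤ q₀ * e.1 + a₀ ∧ (e.2.1 : ℤ) ∣ q₀ * e.1 + a₀) ∧
            (1 ≤ q₁ * e.1 + a₁ ∧ (e.2.2 : ℤ) ∣ q₁ * e.1 + a₁)) ∧ True)).card : ℝ) := by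
          exact_mod_cast Finset.card_le_card hsub
      _ ≤ _ := card_core'_filter_le_sum_tau q₀ a₀ q₁ a₁ (Ioc (x - y) x) Xb (fun _ _ => True)
  -- Assembly of the steps
  calc (∑ s ∈ range SP, ∑ j ∈ range SM, ((((Finset.Ioc (bP s) (bP (s + 1)) ×ˢ Finset.Icc 1 Xb) ×ˢ
          Finset.Ioc (bM j) (bM (j + 1))).filter (fun c : (ℕ × ℕ) × ℕ =>
          (((c.1.2 : ℤ) * c.2 - a₁) % q₁ = 0 ∧
            (1 ≤ ((c.1.2 : ℤ) * c.2 - a₁) / q₁ ∧ ((c.1.2 : ℤ) * c.2 - a₁) / q₁ ≤ x) ∧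
            (1 ≤ q₀ * (((c.1.2 : ℤ) * c.2 - a₁) / q₁) + a₀ ∧
              (c.1.1 : ℤ) ∣ q₀ * (((c.1.2 : ℤ) * c.2 - a₁) / q₁) + a₀)) ∧
          (((x : ℝ) ^ (1 - η) < (c.1.1 : ℝ) * c.1.2 ∧
              (c.1.1 : ℝ) * c.1.2 ≤ (x : ℝ) ^ (1 - η) * (bP (s + 1) : ℕ) / (bP s : ℕ)) ∨
           ((x : ℝ) ^ (1 + θ) * (bP s : ℕ) / (bP (s + 1) : ℕ) < (c.1.1 : ℝ) * c.1.2 ∧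
              (c.1.1 : ℝ) * c.1.2 ≤ (x : ℝ) ^ (1 + θ)) ∨
           (((q₁ : ℝ) * x + a₁) * ((bM j : ℕ) + 1) / (bM (j + 1) : ℕ) < (c.1.2 : ℝ) * c.2)))).card : ℝ))
      ≤ ∑ s ∈ range SP, ∑ j ∈ range SM,
          ∑ d₀ ∈ Finset.Ioc (bP s) (bP (s + 1)), ∑ d₁ ∈ Finset.Icc 1 Xb, ∑ m ∈ Finset.Ioc (bM j) (bM (j + 1)),
            g' d₀ d₁ m := Finset.sum_le_sum fun s hs => Finset.sum_le_sum fun j hj => step1 s hs j hj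
    _ = (∑ d₀ ∈ Icc 1 Xb, ∑ d₁ ∈ Icc 1 Xb, ∑ m ∈ Icc 1 Xb, g' d₀ d₁ m) -
          ∑ d₀ ∈ Icc 1 Xb, ∑ d₁ ∈ Icc 1 Xb, ∑ m ∈ Icc 1 M₀, g' d₀ d₁ m := by linarith [hdec]
    _ ≤ ((cube.filter (fun c => Core c ∧ U c)).card : ℝ) := by linarith [hfull, hsmall0]
    _ ≤ _ := hsplit
    _ ≤ _ := add_le_add (add_le_add (by exact_mod_cast hI₁) (by exact_mod_cast hI₂))
        ((show ((cube.filter (fun c => Core c ∧ U₃ c)).card : ℝ) ≤ _ by exact_mod_cast hI₃).trans hI₃')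


end MiddleAssembly

/-- **Auxiliary stub `stub_pair_middle_shellcards`** (head of this helper file; line
eta-free-multilinear-window, parent stub `stub_pair_middle`): the per-box shell configurations add up to the
three uniform shell counts — `MiddleAssembly.shell_cards_sum_le` in closed form. -/
theorem stub_pair_middle_shellcards :
    ∀ (q₀ a₀ q₁ a₁ : ℤ), 0 < q₁ → ∀ (x Xb BP TP M₀ TM SP SM : ℕ) (bP bM : ℕ → ℕ),
      Monotone bP → Monotone bM → bP 0 = BP → bP SP = TP → bM 0 = M₀ → bM SM = TM → TP ≤ Xb → M₀ ≤ TM →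
      TM ≤ Xb → 1 ≤ BP → ∀ (κ θ η : ℝ), 0 < κ → a₁.natAbs ≤ x →
      (∀ s, ((bP (s + 1) : ℕ) : ℝ) ≤ (1 + 2 * κ) * bP s) →
      (∀ j, ((bM (j + 1) : ℕ) : ℝ) ≤ (1 + 2 * κ) * ((bM j : ℝ) + 1)) →
    (∑ s ∈ Finset.range SP, ∑ j ∈ Finset.range SM,
      ((((Finset.Ioc (bP s) (bP (s + 1)) ×ˢ Finset.Icc 1 Xb) ×ˢ Finset.Ioc (bM j) (bM (j + 1))).filter
        (fun c : (ℕ × ℕ) × ℕ =>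
          (((c.1.2 : ℤ) * c.2 - a₁) % q₁ = 0 ∧
            (1 ≤ ((c.1.2 : ℤ) * c.2 - a₁) / q₁ ∧ ((c.1.2 : ℤ) * c.2 - a₁) / q₁ ≤ x) ∧
            (1 ≤ q₀ * (((c.1.2 : ℤ) * c.2 - a₁) / q₁) + a₀ ∧
              (c.1.1 : ℤ) ∣ q₀ * (((c.1.2 : ℤ) * c.2 - a₁) / q₁) + a₀)) ∧
          (((x : ℝ) ^ (1 - η) < (c.1.1 : ℝ) * c.1.2 ∧
              (c.1.1 : ℝ) * c.1.2 ≤ (x : ℝ) ^ (1 - η) * (bP (s + 1) : ℕ) / (bP s : ℕ)) ∨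
           ((x : ℝ) ^ (1 + θ) * (bP s : ℕ) / (bP (s + 1) : ℕ) < (c.1.1 : ℝ) * c.1.2 ∧
              (c.1.1 : ℝ) * c.1.2 ≤ (x : ℝ) ^ (1 + θ)) ∨
           (((q₁ : ℝ) * x + a₁) * ((bM j : ℕ) + 1) / (bM (j + 1) : ℕ) < (c.1.2 : ℝ) * c.2)))).card : ℝ)) ≤
    ((((Finset.Icc 1 x) ×ˢ ((Finset.Icc 1 Xb) ×ˢ (Finset.Icc 1 Xb))).filter fun e : ℕ × ℕ × ℕ =>
        ((1 ≤ q₀ * e.1 + a₀ ∧ (e.2.1 : ℤ) ∣ q₀ * e.1 + a₀) ∧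
          (1 ≤ q₁ * e.1 + a₁ ∧ (e.2.2 : ℤ) ∣ q₁ * e.1 + a₁)) ∧
        ((x : ℝ) ^ (1 - η) < (e.2.1 : ℝ) * e.2.2 ∧
          (e.2.1 : ℝ) * e.2.2 ≤ (x : ℝ) ^ (1 - η) + (2 * κ) * (x : ℝ) ^ (1 - η))).card : ℝ) +
    ((((Finset.Icc 1 x) ×ˢ ((Finset.Icc 1 Xb) ×ˢ (Finset.Icc 1 Xb))).filter fun e : ℕ × ℕ × ℕ =>
        ((1 ≤ q₀ * e.1 + a₀ ∧ (e.2.1 : ℤ) ∣ q₀ * e.1 + a₀) ∧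
          (1 ≤ q₁ * e.1 + a₁ ∧ (e.2.2 : ℤ) ∣ q₁ * e.1 + a₁)) ∧
        ((x : ℝ) ^ (1 + θ) / (1 + 2 * κ) < (e.2.1 : ℝ) * e.2.2 ∧
          (e.2.1 : ℝ) * e.2.2 ≤ (x : ℝ) ^ (1 + θ) / (1 + 2 * κ) + (2 * κ) * ((x : ℝ) ^ (1 + θ) / (1 + 2 * κ)))).card : ℝ) +
    ∑ n ∈ Finset.Ioc (x - ⌈2 * κ * ((x : ℝ) + a₁.natAbs)⌉₊) x,
      ((((q₀ * n + a₀).toNat).divisors.card : ℕ) : ℝ) * ((((q₁ * n + a₁).toNat).divisors.card : ℕ) : ℝ) :=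
  fun _ _ _ _ hq₁ _ _ _ _ _ _ _ _ bP bM hbP hbM hP0 hPS hM0 hMS hTP hM₀ hTMX hBP _ _ _ hκ hax hratP hratM =>
    MiddleAssembly.shell_cards_sum_le hq₁ bP bM hbP hbM hP0 hPS hM0 hMS hTP hM₀ hTMX hBP hκ hax hratP hratM


end Summit.Parity.BatemanHorn.Theorems.PolyMobiusTail.EtaFreeWindow
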